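import Mathlib
import HarnessLib
import Summits.RiemannHypothesis.RiemannHypothesis.Theorems.IntegerScrewWalkDirichlet
import Summits.RiemannHypothesis.RiemannHypothesis.Theorems.IntegerScrewFibrePoincare

/-!
# Route `IntegerScrew` — bridges between the three Dirichlet forms of the truncated multiplicative walk

The τ-form of the kernel's generator (`IntegerScrewWalkDirichlet`),
`E(g) = −Σ_{k ≤ M} (g k/k)·(walkGen_M g)(k) = ½ Σ_k Σ_j (walkGen(k,j)/k)(g j − g k)²`,
the t-time DIVISOR form `D(g) = Σ_{x ≤ M} (1/x) Σ_{n ∣ x} Λ(n)(g x − g(x/n))²` (used by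
`IntegerScrewWalkPoincareWeak.walk_poincare_weak_dirichlet`) and the t-time PRIME-POWER form
`Σ_{p ≤ M prime} Σ_{x ≤ M} (1/x) Σ_{d=1}^{v_p x} log p (g x − g(x/p^d))²` (used by `IntegerScrewMartingale`)
are one object:

* **`log_mul_dirichlet_eq_divisor_form`** — `log M · E(g) = D(g)` (detailed balance: every unordered pair
  `{k, k/d}` appears twice in the half-sum, once as a death and once as a birth, with equal weight);
* `sum_divisors_vonMangoldt_eq_sum_primeFactors_pow` — `Σ_{n∣x} Λ(n) F(n) = Σ_{p∣x} Σ_{d=1}^{v_p x} log p·F(p^d)`;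
* **`dirichlet_divisor_form_eq_primePow_form`** — the divisor form equals the prime-power form on `{1,…,M}`.

So `walk_poincare_weak_dirichlet` reads `log 2·Σ(1/x)(g x − g 1)² ≤ ⌊log₂M⌋(1+log M)·log M·E(g)` and the
martingale bound `variance_le_of_room_le` reads on `E(g)` likewise.  RH-free bookkeeping.

References: CONTINUUM-LIMIT §24 (rh-explicit A6-PIVOT); M. Suzuki, J. Lond. Math. Soc. (2) 108 (2023) 1448–1487
[Suzuki2023].
-/

noncomputable section

set_option linter.dupNamespace false -- D-0017: `Summit.<S>.<S>.…` is the designed namespace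

namespace Summit.RiemannHypothesis.RiemannHypothesis.Theorems.IntegerScrew

open Finset ArithmeticFunction

/-! ### `log M · E(g)` is the divisor form -/

/-- Below the diagonal the generator is the death rate: for `1 ≤ j < k`,
`walkGen(k,j) = Λ(k/j)/log M` if `j ∣ k`, else `0`. -/
theorem walkGen_of_lt {M : ℕ} (k j : St M) (hjk : (j : ℕ) < k) :
    walkGen M k j = if (j : ℕ) ∣ k then (Λ ((k : ℕ) / j) : ℝ) / Real.log M else 0 := by
  have hj1 : 1 ≤ (j : ℕ) := (mem_Icc.1 j.2).1
  have hne : k ≠ j := fun h => by rw [h] at hjk; exact lt_irrefl _ hjk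
  have hndvd : ¬ (k : ℕ) ∣ j := fun h => by
    have := Nat.le_of_dvd (by omega) h
    omega
  simp only [walkGen, if_neg hne, walkRate]
  rw [if_neg (by intro h; exact hne (Subtype.ext h)), if_neg hndvd]

/-- **`log M · E(g) = D(g)`**: the τ-time Dirichlet form of the kernel's generator times `L = log M` is the t-time
divisor form `Σ_{k ≤ M} (1/k) Σ_{d ∣ k} Λ(d)(g(k/d) − g k)²`. -/
theorem log_mul_dirichlet_eq_divisor_form (M : ℕ) (g : ℕ → ℝ) :
    Real.log M * (-(∑ k : St M, g k / (k : ℕ) * ∑ j : St M, walkGen M k j * g j)) =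
      ∑ k ∈ Icc 1 M, 1 / (k : ℝ) * ∑ d ∈ k.divisors, (Λ d : ℝ) * (g (k / d) - g k) ^ 2 := by
  rcases Nat.eq_zero_or_pos M with rfl | hMpos
  · simp
  rw [dirichlet_eq_half_sum_sq M (fun k => g k)]
  -- pass to sums over `Icc 1 M`
  have hcoe : ∑ k : St M, ∑ j : St M, walkGen M k j / (k : ℕ) * (g j - g k) ^ 2 =
      ∑ k ∈ Icc 1 M, ∑ j ∈ Icc 1 M,
        (if h : k ∈ Icc 1 M ∧ j ∈ Icc 1 M then walkGen M ⟨k, h.1⟩ ⟨j, h.2⟩ / (k : ℕ) * (g j - g k) ^ 2 else 0) := by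
    rw [← Finset.sum_coe_sort (Icc 1 M)]
    refine Finset.sum_congr rfl fun k _ => ?_
    rw [← Finset.sum_coe_sort (Icc 1 M)]
    refine Finset.sum_congr rfl fun j _ => ?_
    rw [dif_pos ⟨k.2, j.2⟩]
  -- the summand is symmetric with zero diagonal (detailed balance)
  set S : ℕ → ℕ → ℝ := fun k j =>
    if h : k ∈ Icc 1 M ∧ j ∈ Icc 1 M then walkGen M ⟨k, h.1⟩ ⟨j, h.2⟩ / (k : ℕ) * (g j - g k) ^ 2 else 0
    with hS
  have hsymm : ∀ k j, S k j = S j k := by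
    intro k j
    simp only [hS]
    by_cases h : k ∈ Icc 1 M ∧ j ∈ Icc 1 M
    · rw [dif_pos h, dif_pos ⟨h.2, h.1⟩, walkGen_detailed_balance M ⟨k, h.1⟩ ⟨j, h.2⟩]
      ring
    · have h' : ¬ (j ∈ Icc 1 M ∧ k ∈ Icc 1 M) := fun h' => h ⟨h'.2, h'.1⟩
      rw [dif_neg h, dif_neg h']
  have hdiag : ∀ k, S k k = 0 := by
    intro k; simp only [hS]; split_ifs <;> simp
  have hhalf := two_mul_sum_sum_lt (Icc 1 M) S hsymm hdiag
  rw [hcoe, ← hhalf]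
  -- below the diagonal only deaths survive
  have hlow : ∀ k ∈ Icc 1 M, ∑ j ∈ Icc 1 M with j < k, S k j =
      ∑ d ∈ k.divisors, (Λ d : ℝ) / Real.log M / (k : ℕ) * (g (k / d) - g k) ^ 2 := by
    intro k hk
    have hk1 : 1 ≤ k := (mem_Icc.1 hk).1
    have hkM : k ≤ M := (mem_Icc.1 hk).2
    have hk0 : k ≠ 0 := by omega
    -- rewrite the summand for j < k
    have h1 : ∑ j ∈ Icc 1 M with j < k, S k j =
        ∑ j ∈ Icc 1 M with j < k, (if j ∣ k then (Λ (k / j) : ℝ) / Real.log M else 0) / (k : ℕ) * (g j - g k) ^ 2 := by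
      refine Finset.sum_congr rfl fun j hj => ?_
      obtain ⟨hjI, hjk⟩ := mem_filter.1 hj
      simp only [hS, dif_pos (show k ∈ Icc 1 M ∧ j ∈ Icc 1 M from ⟨hk, hjI⟩)]
      rw [walkGen_of_lt ⟨k, hk⟩ ⟨j, hjI⟩ hjk]
    rw [h1]
    -- restrict to the divisors `j < k`, then add the vanishing term `j = k` and reindex `d = k/j`
    have h2 : ∑ j ∈ Icc 1 M with j < k, (if j ∣ k then (Λ (k / j) : ℝ) / Real.log M else 0) / (k : ℕ) * (g j - g k) ^ 2 =
        ∑ j ∈ k.divisors, (Λ (k / j) : ℝ) / Real.log M / (k : ℕ) * (g j - g k) ^ 2 := by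
      rw [← Finset.sum_filter_add_sum_filter_not ((Icc 1 M).filter (fun j => j < k)) (fun j => j ∣ k)]
      have hz : ∑ j ∈ ((Icc 1 M).filter (fun j => j < k)).filter (fun j => ¬ j ∣ k),
          (if j ∣ k then (Λ (k / j) : ℝ) / Real.log M else 0) / (k : ℕ) * (g j - g k) ^ 2 = 0 :=
        Finset.sum_eq_zero fun j hj => by rw [if_neg (mem_filter.1 hj).2]; simp
      rw [hz, add_zero]
      -- the divisors of k other than k itself
      have hset : ((Icc 1 M).filter (fun j => j < k)).filter (fun j => j ∣ k) = k.divisors.erase k := by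
        ext j
        simp only [mem_filter, mem_Icc, mem_erase, Nat.mem_divisors]
        constructor
        · rintro ⟨⟨⟨hj1, hjM⟩, hjk⟩, hdvd⟩; exact ⟨by omega, hdvd, hk0⟩
        · rintro ⟨hne, hdvd, -⟩
          have hjle := Nat.le_of_dvd (by omega) hdvd
          exact ⟨⟨⟨Nat.pos_of_dvd_of_pos hdvd (by omega), by omega⟩, lt_of_le_of_ne hjle hne⟩, hdvd⟩
      rw [hset, ← Finset.sum_erase_add _ _ (Nat.mem_divisors_self k hk0)]
      have hkk : (Λ (k / k) : ℝ) / Real.log M / (k : ℕ) * (g k - g k) ^ 2 = 0 := by simp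
      rw [hkk, add_zero]
      refine Finset.sum_congr rfl fun j hj => ?_
      rw [if_pos (Nat.mem_divisors.1 (mem_of_mem_erase hj)).1]
    rw [h2, ← Nat.sum_div_divisors k (fun d => (Λ d : ℝ) / Real.log M / (k : ℕ) * (g (k / d) - g k) ^ 2)]
    refine Finset.sum_congr rfl fun j hj => ?_
    rw [Nat.div_div_self (Nat.mem_divisors.1 hj).1 hk0]
  rw [Finset.sum_congr rfl hlow]
  have hlog : Real.log M ≠ 0 ∨ M = 1 := by
    by_cases h1 : M = 1
    · exact Or.inr h1
    · left; exact Real.log_ne_zero_of_pos_of_ne_one (by exact_mod_cast hMpos) (by exact_mod_cast h1)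
  have h12 : ∀ X : ℝ, (1 : ℝ) / 2 * (2 * X) = X := fun X => by ring
  rw [h12]
  rcases hlog with hlog | rfl
  · rw [Finset.mul_sum]
    refine Finset.sum_congr rfl fun k hk => ?_
    have hk0 : (k : ℝ) ≠ 0 := by have := (mem_Icc.1 hk).1; positivity
    rw [Finset.mul_sum, Finset.mul_sum]
    refine Finset.sum_congr rfl fun d _ => ?_
    field_simp
  · -- M = 1: both sides vanish (Λ(1) = 0)
    simp

/-! ### The divisor form is the prime-power form -/

/-- **`Σ_{n ∣ x} Λ(n) F(n) = Σ_{p ∣ x} Σ_{d=1}^{v_p x} log p · F(p^d)`** — only prime powers carry von Mangoldt weight. -/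
theorem sum_divisors_vonMangoldt_eq_sum_primeFactors_pow {x : ℕ} (hx : x ≠ 0) (F : ℕ → ℝ) :
    ∑ n ∈ x.divisors, (Λ n : ℝ) * F n =
      ∑ p ∈ x.primeFactors, ∑ d ∈ Icc 1 (x.factorization p), Real.log p * F (p ^ d) := by
  -- drop the divisors that are not prime powers
  rw [← Finset.sum_filter_add_sum_filter_not x.divisors IsPrimePow]
  have hz : ∑ n ∈ x.divisors with ¬ IsPrimePow n, (Λ n : ℝ) * F n = 0 :=
    Finset.sum_eq_zero fun n hn => by rw [vonMangoldt_eq_zero_iff.2 (mem_filter.1 hn).2, zero_mul]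
  rw [hz, add_zero, Finset.sum_sigma']
  -- bijection n ↦ (minFac n, v_{minFac n}(n)) from the prime-power divisors onto {(p, d) : p ∣ x, 1 ≤ d ≤ v_p x}
  refine Finset.sum_nbij' (fun n => (⟨n.minFac, n.factorization n.minFac⟩ : Σ _ : ℕ, ℕ))
    (fun σ => σ.1 ^ σ.2) ?_ ?_ ?_ ?_ ?_
  · intro n hn
    obtain ⟨hnd, hpp⟩ := mem_filter.1 hn
    have hndvd : n ∣ x := (Nat.mem_divisors.1 hnd).1
    have hmin : n.minFac.Prime := Nat.minFac_prime hpp.ne_one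
    have hdec : n.minFac ^ n.factorization n.minFac = n := hpp.minFac_pow_factorization_eq
    refine Finset.mem_sigma.2 ⟨?_, ?_⟩
    · exact Nat.mem_primeFactors.2 ⟨hmin, (Nat.minFac_dvd n).trans hndvd, hx⟩
    · refine mem_Icc.2 ⟨?_, ?_⟩
      · exact hmin.factorization_pos_of_dvd hpp.ne_zero (Nat.minFac_dvd n)
      · exact (hmin.pow_dvd_iff_le_factorization hx).1 (hdec.symm ▸ hndvd)
  · intro σ hσ
    obtain ⟨hp, hd⟩ := Finset.mem_sigma.1 hσ
    have hpp : σ.1.Prime := Nat.prime_of_mem_primeFactors hp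
    obtain ⟨hd1, hdv⟩ := mem_Icc.1 hd
    refine mem_filter.2 ⟨Nat.mem_divisors.2 ⟨(hpp.pow_dvd_iff_le_factorization hx).2 hdv, hx⟩, ?_⟩
    exact (isPrimePow_nat_iff _).2 ⟨σ.1, σ.2, hpp, hd1, rfl⟩
  · intro n hn
    exact (mem_filter.1 hn).2.minFac_pow_factorization_eq
  · intro σ hσ
    obtain ⟨p, d⟩ := σ
    obtain ⟨hp, hd⟩ := Finset.mem_sigma.1 hσ
    have hpp : p.Prime := Nat.prime_of_mem_primeFactors hp
    have hd0 : d ≠ 0 := by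
      intro h0; subst h0; simp at hd
    simp only
    rw [hpp.pow_minFac hd0, Nat.factorization_pow_self hpp]
  · intro n hn
    obtain ⟨_, hpp⟩ := mem_filter.1 hn
    have hmin : n.minFac.Prime := Nat.minFac_prime hpp.ne_one
    have hdec : n.minFac ^ n.factorization n.minFac = n := hpp.minFac_pow_factorization_eq
    have hk0 : n.factorization n.minFac ≠ 0 :=
      (hmin.factorization_pos_of_dvd hpp.ne_zero (Nat.minFac_dvd n)).ne'
    simp only
    rw [hdec]
    congr 1
    rw [← hdec, vonMangoldt_apply_pow hk0, vonMangoldt_apply_prime hmin, hdec]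

/-- **The divisor form equals the prime-power form on `{1,…,M}`.** -/
theorem dirichlet_divisor_form_eq_primePow_form (M : ℕ) (g : ℕ → ℝ) :
    ∑ x ∈ Icc 1 M, 1 / (x : ℝ) * ∑ n ∈ x.divisors, (Λ n : ℝ) * (g x - g (x / n)) ^ 2 =
      ∑ p ∈ (Ico 2 (M + 1)).filter Nat.Prime,
        ∑ x ∈ Icc 1 M, 1 / (x : ℝ) * ∑ d ∈ Icc 1 (x.factorization p), Real.log p * (g x - g (x / p ^ d)) ^ 2 := by
  rw [Finset.sum_comm]
  refine Finset.sum_congr rfl fun x hx => ?_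
  have hx1 : 1 ≤ x := (mem_Icc.1 hx).1
  have hx0 : x ≠ 0 := by omega
  rw [← Finset.mul_sum, sum_divisors_vonMangoldt_eq_sum_primeFactors_pow hx0 (fun n => (g x - g (x / n)) ^ 2)]
  congr 1
  -- primeFactors x ⊆ primes ≤ M, and the inner sum vanishes for p ∤ x
  refine Finset.sum_subset ?_ ?_
  · intro p hp
    have hpp := Nat.prime_of_mem_primeFactors hp
    have hple : p ≤ x := Nat.le_of_mem_primeFactors hp
    exact mem_filter.2 ⟨mem_Ico.2 ⟨hpp.two_le, by have := (mem_Icc.1 hx).2; omega⟩, hpp⟩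
  · intro p hp hnot
    have hpp : p.Prime := (mem_filter.1 hp).2
    have h0 : x.factorization p = 0 := by
      rw [Nat.factorization_eq_zero_iff]
      right; left
      intro hdvd
      exact hnot (Nat.mem_primeFactors.2 ⟨hpp, hdvd, hx0⟩)
    rw [h0]
    simp

end Summit.RiemannHypothesis.RiemannHypothesis.Theorems.IntegerScrew

end
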